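import Literature.AlgebraicGeometry.Resolution.BlowupChartModule
import Literature.AlgebraicGeometry.Resolution.BlowupAlgebraDerivations
import HarnessLib

/-!
# [OURS · L1 W4.5(b)] T-AUXFIBRE: blowing up a smooth curve germ through a point of multiplicity `≥ 2` puts the whole exceptional fibre into the strict transform

Crux chain w45b, working crux EL♮ = `Theses.EquisingularLift.EquisingularLiftNat` (stmt-ResolutionOfSingularities-20038), stub
`stub_elnat_three_isolated`; target **T-AUXFIBRE** of res-L1-w45b-lead-2 (NAMING 2026-08-27T06:32:06Z, LEAD-MEMO-2 §4), chart
algebra in the style of AVOID-L1 (`…CampaignW45bAvoidBadPoint`) / Δ-MULT (`…CampaignW45bStrictTransformMultiplicity`). OURS;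
NOT a statement of any manuscript; AI-written, weaker than expert review. `--supports stmt-ResolutionOfSingularities-20038 --as helper`.

SETTING (lead-2's words): `R` regular local with closed point `q`, `R′ = R/(u, v)` regular — `u, v` part of a regular system of
parameters, i.e. (the form used here, no regularity of `R` needed) `u ∉ 𝔪² + (v)` and `v ∉ 𝔪² + (u)` — a smooth curve germ
`C = V(u, v)` through `q`; `f ∈ (u, v)` (the hypersurface `H = V(f)` contains `C`) with `f ∈ 𝔪²` (multiplicity `≥ 2` at `q`, while
the multiplicity of `H` along `C` is only `≥ 1`). In the chart `B = R[(u,v)/v]` (`u = v·u′`) of `Bl_C`: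

* `coeff_mem_maximalIdeal_of_mem_sq` — writing `f = A u + B v`, BOTH `A, B ∈ 𝔪` (a unit `A` would put `u` in `𝔪² + (v)`);
* `divPow_one_eq` — `f/v = A·(u/v) + B` in `R[(u,v)/v]` (any pair, any commutative ring);
* **`divPow_one_mem_map_maximalIdeal`** (T-AUXFIBRE) — hence the strict transform `f/v ∈ 𝔪·R[(u,v)/v]`: it lies in EVERY prime
  of the chart over `q` («the whole fibre of `E` over `q` lies in the strict transform when `mult_q f ≥ 2 > 1 =` mult along the
  centre»), `divPow_one_mem_of_map_le`; the `u`-chart statement is the same lemma with `u, v` exchanged (`Ideal.span {u, v}` is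
  symmetric: `divPow_one_mem_map_maximalIdeal'`).

This is the obstruction lead-2's MEMO-2 §1 records for curve centres THROUGH a point of higher multiplicity (the E1 game must first
lower the multiplicity at `q` by point/section steps). References: res-L1-w45b-lead-2 LEAD-MEMO-2 §1/§4 (OURS); J. Kollár,
*Lectures on Resolution of Singularities* (2007), §3.9 — context only.
-/

noncomputable section

set_option linter.dupNamespace false -- mandated namespace `Summit.<Summit>.<Problem>` of this single-conjunct summit

open IsLocalRing IsLocalization
open Literature.AlgebraicGeometry.Resolution

namespace Summit.ResolutionOfSingularities.ResolutionOfSingularities.Cruxes.EquisingularLiftNat.Sections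

universe u

section AnyRing

variable {R : Type u} [CommRing R]

/-- **`f/a = A + (b/a)·B` in `R[I/a]`** for `f = a A + b B` with `b ∈ I`, `f ∈ I¹`. [folklore] -/
theorem divPow_one_eq (I : Ideal R) {a b f A B : R} (hb : b ∈ I) (hf : f ∈ I ^ 1) (hfab : f = a * A + b * B) :
    blowupAlgebra.divPow I a hf =
      algebraMap R (blowupAlgebra I a) A + blowupAlgebra.gen I a b hb * algebraMap R (blowupAlgebra I a) B := by
  apply Subtype.ext
  have hea : algebraMap R (Localization.Away a) a * Away.invSelf a = 1 := Away.mul_invSelf a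
  simp only [blowupAlgebra.coe_divPow, Subalgebra.coe_add, Subalgebra.coe_mul, Subalgebra.coe_algebraMap,
    blowupAlgebra.coe_gen, hfab, map_add, map_mul, pow_one]
  linear_combination (algebraMap R (Localization.Away a) A) * hea

/-- If the coefficients `A, B` of `f = a A + b B` lie in an ideal `𝔞`, then `f/a ∈ 𝔞·R[I/a]`. [folklore] -/
theorem divPow_one_mem_map_of_coeff_mem (I : Ideal R) {a b f A B : R} (hb : b ∈ I) (hf : f ∈ I ^ 1)
    (hfab : f = a * A + b * B) (𝔞 : Ideal R) (hA : A ∈ 𝔞) (hB : B ∈ 𝔞) :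
    blowupAlgebra.divPow I a hf ∈ 𝔞.map (algebraMap R (blowupAlgebra I a)) := by
  rw [divPow_one_eq I hb hf hfab]
  exact Ideal.add_mem _ (Ideal.mem_map_of_mem _ hA) (Ideal.mul_mem_left _ _ (Ideal.mem_map_of_mem _ hB))

end AnyRing

section Local

variable {R : Type u} [CommRing R] [IsLocalRing R] {u v f : R}

/-- **Both coefficients of `f = A u + B v` lie in `𝔪`** when `f ∈ 𝔪²` and `u, v` are independent regular parameters in the weak
sense `u ∉ 𝔪² + (v)`, `v ∉ 𝔪² + (u)`: a unit `A` would give `u = A⁻¹(f − Bv) ∈ 𝔪² + (v)`. [folklore] -/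
theorem coeff_mem_maximalIdeal_of_mem_sq (hu : u ∉ maximalIdeal R ^ 2 ⊔ Ideal.span {v})
    (hv : v ∉ maximalIdeal R ^ 2 ⊔ Ideal.span {u}) (hf2 : f ∈ maximalIdeal R ^ 2) {A B : R}
    (hfab : f = u * A + v * B) : A ∈ maximalIdeal R ∧ B ∈ maximalIdeal R := by
  constructor
  · by_contra hA
    have hAu : IsUnit A := by by_contra h; exact hA ((mem_maximalIdeal _).mpr h)
    apply hu
    have hu' : u = (f - v * B) * hAu.unit⁻¹ := by
      rw [hfab, add_sub_cancel_right, mul_assoc, IsUnit.mul_val_inv, mul_one]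
    rw [hu']
    refine Ideal.mul_mem_right _ _ (Ideal.sub_mem _ (Ideal.mem_sup_left hf2) ?_)
    exact Ideal.mem_sup_right (Ideal.mul_mem_right _ _ (Ideal.mem_span_singleton_self v))
  · by_contra hB
    have hBu : IsUnit B := by by_contra h; exact hB ((mem_maximalIdeal _).mpr h)
    apply hv
    have hv' : v = (f - u * A) * hBu.unit⁻¹ := by
      rw [hfab, add_sub_cancel_left, mul_assoc, IsUnit.mul_val_inv, mul_one]
    rw [hv']
    refine Ideal.mul_mem_right _ _ (Ideal.sub_mem _ (Ideal.mem_sup_left hf2) ?_)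
    exact Ideal.mem_sup_right (Ideal.mul_mem_right _ _ (Ideal.mem_span_singleton_self u))

/-- **T-AUXFIBRE (`v`-chart).** `R` local, `u ∉ 𝔪² + (v)`, `v ∉ 𝔪² + (u)` (independent regular parameters: `C = V(u,v)` a smooth
curve germ through the closed point `q`), `f ∈ (u, v)` with `f ∈ 𝔪²` (`H = V(f) ⊇ C` has multiplicity `≥ 2` at `q`). Then in the
chart `B = R[(u,v)/v]` of `Bl_C` the strict transform `f/v` lies in `𝔪·B` — i.e. in every prime of the chart over `q`: the whole
exceptional fibre over `q` lies on the strict transform of `H`. [folklore; lead-2 LEAD-MEMO-2 §4 T-AUXFIBRE] -/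
theorem divPow_one_mem_map_maximalIdeal (hu : u ∉ maximalIdeal R ^ 2 ⊔ Ideal.span {v})
    (hv : v ∉ maximalIdeal R ^ 2 ⊔ Ideal.span {u}) (hf2 : f ∈ maximalIdeal R ^ 2)
    (hf : f ∈ Ideal.span {u, v} ^ 1) :
    blowupAlgebra.divPow (Ideal.span {u, v}) v hf ∈
      (maximalIdeal R).map (algebraMap R (blowupAlgebra (Ideal.span {u, v}) v)) := by
  have hf' : f ∈ Ideal.span {u, v} := by simpa only [pow_one] using hf
  obtain ⟨A, B, hAB⟩ := Ideal.mem_span_pair.mp hf'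
  have hfab : f = u * A + v * B := by rw [← hAB]; ring
  obtain ⟨hA, hB⟩ := coeff_mem_maximalIdeal_of_mem_sq hu hv hf2 hfab
  have hfab' : f = v * B + u * A := by rw [hfab]; ring
  exact divPow_one_mem_map_of_coeff_mem (Ideal.span {u, v}) (Ideal.subset_span (by simp)) hf hfab'
    (maximalIdeal R) hB hA

/-- **T-AUXFIBRE (`u`-chart).** The same in the chart `B′ = R[(u,v)/u]`: `f/u ∈ 𝔪·B′`. [folklore; lead-2 LEAD-MEMO-2 §4] -/
theorem divPow_one_mem_map_maximalIdeal' (hu : u ∉ maximalIdeal R ^ 2 ⊔ Ideal.span {v})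
    (hv : v ∉ maximalIdeal R ^ 2 ⊔ Ideal.span {u}) (hf2 : f ∈ maximalIdeal R ^ 2)
    (hf : f ∈ Ideal.span {u, v} ^ 1) :
    blowupAlgebra.divPow (Ideal.span {u, v}) u hf ∈
      (maximalIdeal R).map (algebraMap R (blowupAlgebra (Ideal.span {u, v}) u)) := by
  have hf' : f ∈ Ideal.span {u, v} := by simpa only [pow_one] using hf
  obtain ⟨A, B, hAB⟩ := Ideal.mem_span_pair.mp hf'
  have hfab : f = u * A + v * B := by rw [← hAB]; ring
  obtain ⟨hA, hB⟩ := coeff_mem_maximalIdeal_of_mem_sq hu hv hf2 hfab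
  exact divPow_one_mem_map_of_coeff_mem (Ideal.span {u, v}) (Ideal.subset_span (by simp)) hf hfab
    (maximalIdeal R) hA hB

/-- **T-AUXFIBRE, point form.** Under the same hypotheses the strict transform `f/v` lies in every ideal of the `v`-chart
containing `𝔪·R[(u,v)/v]` — every point of the exceptional fibre over `q`. [folklore; lead-2 LEAD-MEMO-2 §4] -/
theorem divPow_one_mem_of_map_le (hu : u ∉ maximalIdeal R ^ 2 ⊔ Ideal.span {v})
    (hv : v ∉ maximalIdeal R ^ 2 ⊔ Ideal.span {u}) (hf2 : f ∈ maximalIdeal R ^ 2)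
    (hf : f ∈ Ideal.span {u, v} ^ 1) (𝔔 : Ideal (blowupAlgebra (Ideal.span {u, v}) v))
    (h𝔔 : (maximalIdeal R).map (algebraMap R (blowupAlgebra (Ideal.span {u, v}) v)) ≤ 𝔔) :
    blowupAlgebra.divPow (Ideal.span {u, v}) v hf ∈ 𝔔 :=
  h𝔔 (divPow_one_mem_map_maximalIdeal hu hv hf2 hf)

/-- For a REGULAR local ring the weak independence hypotheses follow from `(u, v)` being part of a regular system of parameters in
the usual form «`u ∈ 𝔪 ∖ 𝔪²` and `v̄ ∉ k·ū` in `𝔪/𝔪²`»; recorded here in the purely ideal-theoretic form used above: if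
`u ∉ 𝔪² + (v)` then in particular `u ∉ 𝔪²`. [folklore] -/
theorem notMem_sq_of_notMem_sq_sup (hu : u ∉ maximalIdeal R ^ 2 ⊔ Ideal.span {v}) : u ∉ maximalIdeal R ^ 2 :=
  fun h => hu (Ideal.mem_sup_left h)

end Local

end Summit.ResolutionOfSingularities.ResolutionOfSingularities.Cruxes.EquisingularLiftNat.Sections

end
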